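import Summits.QuantumFields.YangMills.Theorems.TwistedTraceScaling.Negative.WindowLargeFieldEntropy
import HarnessLib

/-!
# `TwistedTraceScaling` (crux stmt-QuantumFields-20203, route `LuscherReduction`, skeleton «twolattice» rev 3):
# negative-side support R80b — the femto 4-volume weight at a FIXED lattice size (companion of R80 `WindowLargeFieldEntropy`)
# (refuter crux-disprover seat; this file does NOT refute the crux)

HONEST FRAMING as in R80: femto rung of a CONDITIONAL reduction route; not infinite volume, not a mass gap, not Clay; no definition, no
`Theses` import, no `sorry`.

R80 shows that along the two-loop femto WINDOW (`L → ∞` at fixed depth `lam`) the femto 4-volume weight of one action defect,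
`L³ · T_s · e^{−δβ}` (`T_s = femtoSteps s β L = ⌈sL/Λ(β, L)⌉₊` lattice time steps), is unbounded for every `δ < 1/b₀ = 24π²/11`
(`R80.femtoVolume_defect_unbounded`).  This companion types the CONTRAST with the regime of the closed fixed-lattice stub S-BASE
(`Stmt.stub_fixedLatticeTraceLaw`, `β → ∞` at fixed `L`): there the femto time extent grows only like `β` (`T_s ≤ sLβ + 1` for `β ≥ 1`,
`femtoSteps_le_of_one_le` — `1/Λ ≤ max 1 (1/ḡ²) ≤ β`), so `L³ · T_s · e^{−δβ} → 0` for every `δ > 0` (`femtoVolume_defect_tendsto_zero_fixedL`).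
The fixed-lattice regime carries no large-field entropy; the window regime does — one more face of the open swap `∀ L ∃` versus `∃ ∀ L`
(`R75c.labelLimit_pointwise` versus LIM).
-/

set_option autoImplicit false

noncomputable section

open MeasureTheory Filter Topology Real
open Literature.MathematicalPhysics.QuantumFieldTheory hiding SU2
open Literature.MathematicalPhysics.QuantumLattice
open Literature.Analysis.OperatorTheory.YMMatrixModel
open scoped BigOperators

namespace Summit.QuantumFields.YangMills.Theorems.TwistedTraceScaling.Negative.R80b

open Summit.QuantumFields.YangMills.Theorems.FemtoTransferGap
open Summit.QuantumFields.YangMills.Theorems.FemtoTransferGap.TraceDoor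

/-- For `β ≥ 1` and `s ≥ 0` the femto time extent is at most `sLβ + 1` steps on any lattice (`1/Λ ≤ max 1 (1/ḡ²) ≤ β`, since `(1/Λ)³ = 1/ḡ² ≤
β/2`; and `T_s = 0` by the junk convention where `1/ḡ² ≤ 0`). [folklore] -/
theorem femtoSteps_le_of_one_le {s β : ℝ} (hs : 0 ≤ s) (hβ : 1 ≤ β) (L : ℕ) [NeZero L] :
    (femtoSteps s β L : ℝ) ≤ s * L * β + 1 := by
  unfold femtoSteps
  by_cases hx : 0 < invRunningCoupling β L
  · have hl3 := BOHandover.luscherLambda_pow_three hx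
    have hlpos : 0 < luscherLambda β L := by
      unfold luscherLambda; rw [max_eq_left hx.le]; exact Real.rpow_pos_of_pos hx _
    have hxle : invRunningCoupling β L ≤ β / 2 := BOHandover.invRunningCoupling_le_half hβ L
    have hinv : 1 / luscherLambda β L ≤ β := by
      by_cases h1 : 1 ≤ 1 / luscherLambda β L
      · have h2 : 1 / luscherLambda β L ≤ (1 / luscherLambda β L) ^ 3 := le_self_pow₀ h1 (by norm_num)
        have h3 : (1 / luscherLambda β L) ^ 3 = invRunningCoupling β L := by
          rw [one_div, inv_pow, hl3, inv_inv]
        linarith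
      · linarith
    have h0 : 0 ≤ s * L / luscherLambda β L := by positivity
    have h4 : (⌈s * (L : ℝ) / luscherLambda β L⌉₊ : ℝ) < s * L / luscherLambda β L + 1 := Nat.ceil_lt_add_one h0
    have h5 : s * L / luscherLambda β L = s * L * (1 / luscherLambda β L) := by ring
    have h6 : s * L * (1 / luscherLambda β L) ≤ s * L * β := mul_le_mul_of_nonneg_left hinv (by positivity)
    linarith
  · have hx' : invRunningCoupling β L ≤ 0 := not_lt.mp hx
    have hl0 : luscherLambda β L = 0 := by
      unfold luscherLambda; rw [max_eq_right hx']; exact Real.zero_rpow (by norm_num)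
    rw [hl0, div_zero, Nat.ceil_zero]
    push_cast
    have : 0 ≤ s * L * β := by
      have : (0 : ℝ) ≤ β := by linarith
      positivity
    linarith

/-- At fixed `L` (NeZero), the femto 4-volume weight `L³ · T_s · e^{−δβ} → 0` as `β → ∞` (`s ≥ 0`, `δ > 0`): the S-BASE regime
(`stub_fixedLatticeTraceLaw`, landed) carries no large-field entropy, in contrast with §3. [folklore] -/
theorem femtoVolume_defect_tendsto_zero_fixedL (L : ℕ) [NeZero L] {s δ : ℝ} (hs : 0 ≤ s) (hδ : 0 < δ) :
    Tendsto (fun β : ℝ => (L : ℝ) ^ 3 * (femtoSteps s β L : ℝ) * Real.exp (-(δ * β))) atTop (𝓝 0) := by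
  have h1 : Tendsto (fun β : ℝ => δ * β) atTop atTop := tendsto_id.const_mul_atTop hδ
  have he : Tendsto (fun β : ℝ => Real.exp (-(δ * β))) atTop (𝓝 0) :=
    Real.tendsto_exp_neg_atTop_nhds_zero.comp h1
  have hbe : Tendsto (fun β : ℝ => (δ * β) ^ 1 * Real.exp (-(δ * β))) atTop (𝓝 0) :=
    (Real.tendsto_pow_mul_exp_neg_atTop_nhds_zero 1).comp h1
  have hbe' : Tendsto (fun β : ℝ => β * Real.exp (-(δ * β))) atTop (𝓝 0) := by
    have h2 := hbe.const_mul (1 / δ)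
    rw [mul_zero] at h2
    refine Tendsto.congr (fun β => ?_) h2
    rw [pow_one]
    field_simp
  have hup : Tendsto (fun β : ℝ => (L : ℝ) ^ 3 * (s * L * β + 1) * Real.exp (-(δ * β))) atTop (𝓝 0) := by
    have hsum := (hbe'.const_mul (s * (L : ℝ) ^ 4)).add (he.const_mul ((L : ℝ) ^ 3))
    rw [mul_zero, mul_zero, add_zero] at hsum
    refine Tendsto.congr (fun β => ?_) hsum
    ring
  refine tendsto_of_tendsto_of_tendsto_of_le_of_le' tendsto_const_nhds hup ?_ ?_
  · exact Eventually.of_forall fun β => by positivity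
  · filter_upwards [eventually_ge_atTop (1 : ℝ)] with β hβ
    exact mul_le_mul_of_nonneg_right
      (mul_le_mul_of_nonneg_left (femtoSteps_le_of_one_le hs hβ L) (by positivity)) (Real.exp_pos _).le

/-- **Both regimes at once**: for `0 < δ < 1/b₀`, `s > 0`, depth `lam`, the femto 4-volume weight `L³ · T_s · e^{−δβ}` tends to `0` as
`β → ∞` on EVERY fixed lattice, yet exceeds every bound on the window `W(lam, L)` for all large `L`. [folklore] -/
theorem femtoVolume_defect_fixedL_vs_window {s δ lam : ℝ} (hs : 0 < s) (hδ0 : 0 < δ) (hδ : δ < 1 / b0) (hlam : 0 < lam) :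
    (∀ (L : ℕ) [NeZero L], Tendsto (fun β : ℝ => (L : ℝ) ^ 3 * (femtoSteps s β L : ℝ) * Real.exp (-(δ * β))) atTop (𝓝 0)) ∧
    (∀ M : ℝ, ∃ L1 : ℕ, ∀ (L : ℕ) [NeZero L], L1 ≤ L → ∀ β : ℝ, InFemtoWindow lam β L →
      M ≤ (L : ℝ) ^ 3 * (femtoSteps s β L : ℝ) * Real.exp (-(δ * β))) :=
  ⟨fun L _ => femtoVolume_defect_tendsto_zero_fixedL L hs.le hδ0, fun M => R80.femtoVolume_defect_unbounded hs hδ hlam M⟩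

end Summit.QuantumFields.YangMills.Theorems.TwistedTraceScaling.Negative.R80b

end
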